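/-
Copyright: the b2b-balaban cell (near-miss cell 7), T⁴-continuum fan-out; row NE7b ROUND-2 swarm, seat
t4-ne7b-formalise-leaf-06 (gen 2; successor item «S12d-SLACK» of leaf-03's closing menu, journal l.12155 (2) ∕ l.12166,
owner's ruling R-OWNER-22-23 (2) «default = kernel»; rows S12c∕S12d of `t4/b2b-balaban-t4-ne7b-p1/LEAVES-NE7b.md`).
Released under the licence of the surrounding project.
-/
import Summits.QuantumFields.BalabanUV.T4Continuum.Support.HistoryAssemblyRealiseRunSlack
import Summits.QuantumFields.BalabanUV.T4Continuum.Support.HistoryRealiseCellsRun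

/-!
# Realised histories: THE LAST COUNT-ROAD COMPOSITION WITH THE CLASS-LINEAR SLACK (rows S12c × S12d, printed currency)

Summits-side support leaf of the T⁴-continuum cell (rung (B)+1 on a FINITE torus only; NOT infinite volume, NOT the
mass gap, NOT the Clay statement; NOT a proof of the spine estimate NE7b).  Row NE7b, route «COUNT», ROUND-2 swarm.
[folklore] COMPOSITION BY NAME; nothing is quoted from print, nothing printed is asserted, no `[cite:]` tag, NO
definition, no `Prop`-valued fact of Bałaban's is minted (trigger c1).

WHAT.  **`hybridNE7_of_realisedDomainsRun_printedSlack`** — `HistoryAssemblyRealiseRunSlack.hybridNE7_of_realisedRun_printedSlack`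
(the per-run END of record re-plugged on H3's printed price sentence WITH the per-member factor `e^{θ·birthLinT}`,
ruling R-OWNER-22-23 (2)) at the reading map WITH DOMAINS: `cellOf := cellOfR n F.L (runProfile F.L R) ped cellP`,
`H := HistoryRealiseCellsRun.realisedReadingR_of_domainsRun … hn H` (leaf-08 gen 2's junction (B3): root cells DEFINED,
`cell_mem`∕`cell_inj` PROVED, the run's profile stepwise non-increasing and its drop control FROM THE FLOW).  It is the
slack twin of leaf-08 gen 2's `HistoryRealiseCellsRunEnd.hybridNE7_of_realisedDomainsRun_printed`: binder diff =
only-in-slack {`(hA₀ : 1 ≤ C.A₀)`, `{θ} (hθ : 0 ≤ θ) (hslack : C.a + θ ≤ O.γ₀ * O.A₁ ^ 2 / 2)`, the factor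
`* Real.exp (θ * birthLinT Prod.fst q.2)` inside `hP`∕`hP′`}, only-in-printed {`(hD : Dominates C O)`}; conclusion
token-identical.

WHAT STAYS DISPLAYED: B1 constants (`ThresholdOK`, `0 < μ`, `κ₁ ≥ d log L + 2 log 2`, `E₀ ≥ log (2 + birthMass C)`,
`1 ≤ A₀`) — NOT `Dominates C O`; B2 flow (⇐ BetaPertH) + `β₀ ≤ ½` + `Tuned` + `irThresholdTLE C F.L rr β₀ ≤ log g⁻²` +
(2.5); B3 the (B) side; B4 `Regeneration` numerator fields ×2; B5 ONLY the reading map `ped`∕`cellP`∕`liveC`∕`Zd` with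
`RealisedDomainsR F.L (runProfile F.L R) n K₀ R T ped cellP liveC Zd` + `0 < n` + realised costs `κ ≤ costT` + the
printed price sentences WITH the slack factor; B7 seams; S1b's `4 ≤ F.L`, `13 ≤ C.n₁`, `1 ≤ R K t`.  NO `sP`, NO
`hdrop`, NO `hmono`, NO `cellOf`∕`cell_mem`∕`cell_inj`.

HONEST.  H3 (reading map, `real`, `track`, `disjoint`, `inBox`, prices, numerator readings), (B), BetaPertH-flow stay
DISPLAYED; `BirthShapeNodup` NOT retired by this file; NE7b NOT proved; spine 0∕9.  HONEST DEPENDENCY (cell): continuum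
YM on T⁴ ⇐ BetaPertH ∧ nine spine estimates (0/9 proved); BetaPertH ⇐ (D1) ∧ (D4) ∧ CAP+tail; G-an2-4 gates asym, D1
and NE2/3/4.  This file changes none of it.
-/

open Finset MeasureTheory
open Literature.MathematicalPhysics.QuantumFieldTheory.Balaban1983to89
open Literature.MathematicalPhysics.QuantumFieldTheory.Balaban1983to89.B13ScaleTransfer
open T4PersistenceDictionary T4PersistentHistoryCount T4BankedInduction T4PrintedShapeBanking
open T4WeightBudget T4GlobalDenominator T4LiveClassFibration T4LiveStructureGas T4LiveGasToTerms T4RecordPriceSeam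
open T4PartnerMultiplicity T4IndicatorShell T4MatchingAssembly T4MatchingClosure T4MatchingClosureSocket T4Continuum
open T4StabilitySocket T4BranchingRecordsGas T4TaggedShapeBanking T4CanonicalMenus T4RenewalChains
open Summit.QuantumFields.BalabanUV.T4Continuum.PlacementBatch
open Summit.QuantumFields.BalabanUV.T4Continuum.PlacementSkeleton
open Summit.QuantumFields.BalabanUV.T4Continuum.CountThresholdUniform
open Summit.QuantumFields.BalabanUV.T4Continuum.CountThresholdExit
open Summit.QuantumFields.BalabanUV.T4Continuum.CountSeamJunction
open Summit.QuantumFields.BalabanUV.T4Continuum.LateMergers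
open Summit.QuantumFields.BalabanUV.T4Continuum.HistoryFlow
open Summit.QuantumFields.BalabanUV.T4Continuum.HistoryRegeneration
open Summit.QuantumFields.BalabanUV.T4Continuum.HistoryTables
open Summit.QuantumFields.BalabanUV.T4Continuum.HistoryAssemblyTrees
open Summit.QuantumFields.BalabanUV.T4Continuum.HistoryAssemblyTerms
open Summit.QuantumFields.BalabanUV.T4Continuum.HistoryAssemblyPedigree
open Summit.QuantumFields.BalabanUV.T4Continuum.HistoryConstants
open Summit.QuantumFields.BalabanUV.T4Continuum.HistoryGen
open Summit.QuantumFields.BalabanUV.T4Continuum.ZoneSkeleton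
open Summit.QuantumFields.BalabanUV.T4Continuum.HistorySocketTH
open Summit.QuantumFields.BalabanUV.T4Continuum.HistoryCaps
open Summit.QuantumFields.BalabanUV.T4Continuum.HistoryAssemblyPrice
open Summit.QuantumFields.BalabanUV.T4Continuum.HistoryBankingLE
open Summit.QuantumFields.BalabanUV.T4Continuum.HistoryTreeShapeLE
open Summit.QuantumFields.BalabanUV.T4Continuum.HistoryExitLE
open Summit.QuantumFields.BalabanUV.T4Continuum.HistoryAssemblyTermsLE
open Summit.QuantumFields.BalabanUV.T4Continuum.HistoryRealise
open Summit.QuantumFields.BalabanUV.T4Continuum.HistoryAssemblyRealiseLE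
open Summit.QuantumFields.BalabanUV.T4Continuum.HistoryAssemblyRealisePrice
open Summit.QuantumFields.BalabanUV.T4Continuum.HistoryZones
open Summit.QuantumFields.BalabanUV.T4Continuum.HistoryAssemblyRealiseRun
open Summit.QuantumFields.BalabanUV.T4Continuum.HistoryAssemblyRealiseRunEnd
open Summit.QuantumFields.BalabanUV.T4Continuum.HistoryRealiseCells
open Summit.QuantumFields.BalabanUV.T4Continuum.HistoryRealiseCellsRun

open Summit.QuantumFields.BalabanUV.T4Continuum.HistoryAssemblyRealiseRunSlack

namespace Summit.QuantumFields.BalabanUV.T4Continuum.HistoryRealiseCellsRunSlack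

noncomputable section

section End

variable {F : T4Family} {G : Type*} [GaugeGroup G] [MeasurableSpace G] [HaarData G] [RegularGaugeGroup G]
variable {α π : Type*} [DecidableEq α] [DecidableEq π]
variable {ι : Type*} [DecidableEq ι] {l₀ vol : ℝ} {K₀ : ℕ} {T : ℕ → Finset ι} {A A' shA shB : ℕ → ℝ → ι → ℝ}
  {dead dead' : ℕ → ℝ → ι → ℝ} {nup mup : ℕ → ℝ → ℝ} {Nup : ℝ}
  {Cc Rr CcRec RrRec : ℕ → ℝ → ι → ℝ} {ν u s₂ q₀ r s Wsh : ℕ → ℝ}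

/-! ## The last count-road composition with the slack -/

/-- **… WITH THE LIVE MEMBERS' DOMAINS** (root cells `cellOfR`, `cell_mem`∕`cell_inj` PROVED in `HistoryRealiseCellsRun`):
`hybridNE7_of_realisedRun_printedSlack` at `cellOf := cellOfR n F.L (runProfile F.L R) ped cellP`, `H := realisedReadingR_of_domainsRun … hn H`.  The slack
twin of `HistoryRealiseCellsRunEnd.hybridNE7_of_realisedDomainsRun_printed` (leaf-08 gen 2): binder diff = only-in-slack
{`hA₀`, `θ`∕`hθ`∕`hslack`, the factor `* Real.exp (θ * birthLinT Prod.fst q.2)` in `hP`∕`hP′`}, only-in-printed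
{`hD : Dominates C O`}; conclusion token-identical. [folklore] -/
theorem hybridNE7_of_realisedDomainsRun_printedSlack (D : FiniteEpsData F G) {C : T4PrintedShapeBanking.Consts}
    {O : PrintedO1s}
    {rr : ℕ} {β₀ : ℝ} (h : ThresholdOK C F.L rr β₀) (hμ : 0 < C.μ) (d n : ℕ)
    (hκ₁ : (d : ℝ) * Real.log F.L + 2 * Real.log 2 ≤ C.κ₁) (hE₀ : Real.log (2 + birthMass C) ≤ C.E₀)
    -- the profile floor `p₀(g) ≥ 1` along the runs comes from `1 ≤ A₀` and the flow's `log g⁻² ≥ 1`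
    (hA₀ : 1 ≤ C.A₀)
    -- the flow side (⇐ BetaPertH, displayed) and tuning; `β₀ ≤ ½` for the located smallness of the drop control
    {γ₀ γb b β' : ℝ} {pe : ℕ} (hb : 0 ≤ b) (hlo : FlowStep.BetaLowerH b γ₀ D.βfun)
    (hhi : FlowStep.BetaUpperH β' γ₀ D.βfun) (hγ : γb ≤ γ₀) (hγβ : γb ^ 2 * β' < 1)
    (S : B14FlowStep.SmallnessFor γb β' β₀ F.L pe) (hp₀ : C.p₀ ≤ pe) (hrr : rr ≤ pe) (hβ : β₀ ≤ 1 / 2)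
    {g : ℝ} {g₀ : ℕ → ℝ} (ht : D.Tuned γb g g₀)
    (hir : irThresholdTLE C F.L rr β₀ ≤ Real.log (g ^ 2)⁻¹)
    -- the (B) side
    (hsign : B16.SignConventions D.C) {γB : ℝ} {em ep : ℝ → ℝ} (hcor : B16.Cor3With D.C γB em ep) (hγB : γb ≤ γB)
    {obs : (K : ℕ) → GaugeField (F.P K) 0 G → ℝ} {B : ℝ}
    (hobs : ∀ K, Measurable (obs K)) (hbd : ∀ K U, |obs K U| ≤ B)
    (hα : ∀ K t, |t| ≤ l₀ → K₀ ≤ K →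
      ∫ U, Real.exp (t * obs K U) * D.dens K (g₀ K) 0 U ∂fieldMeasure (F.P K) 0 G ≤ ∑ τ ∈ T K, A K t τ)
    (hα' : ∀ K t, |t| ≤ l₀ → K₀ ≤ K →
      ∫ U, Real.exp (t * obs (K + 1) U) * D.dens (K + 1) (g₀ (K + 1)) 0 U ∂fieldMeasure (F.P (K + 1)) 0 G ≤
        ∑ τ ∈ T K, A' K t τ)
    {c₀ n₁ : ℝ} (hc₀ : 0 < c₀) (hfloor : ∀ K, K₀ ≤ K → c₀ ≤ smallFieldMass D K (g₀ K))
    (hfloor' : ∀ K, K₀ ≤ K → c₀ ≤ smallFieldMass D (K + 1) (g₀ (K + 1)))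
    (hsites : ∀ K, K₀ ≤ K → ((D.C ⟨K, F.m, g₀ K⟩).numSites K : ℝ) ≤ n₁)
    (hsites' : ∀ K, K₀ ≤ K → ((D.C ⟨K + 1, F.m, g₀ (K + 1)⟩).numSites (K + 1) : ℝ) ≤ n₁)
    (hNup : 0 ≤ Nup) (hnup : ∀ K t, |t| ≤ l₀ → K₀ ≤ K → 0 ≤ nup K t ∧ nup K t ≤ Nup)
    (hmup : ∀ K t, |t| ≤ l₀ → K₀ ≤ K → 0 ≤ mup K t ∧ mup K t ≤ Nup)
    -- the (2.5) side condition on the size function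
    (R : ℕ → ℕ → ℕ) (hR : ∀ K s, s ≤ K → B14.IsRj F.L rr ((D.C ⟨K, F.m, g₀ K⟩).flow.g s) (R K s))
    -- the side conditions of the geometric lemmas (row S1b): torus side, window constant, sizes (NO drop control)
    (hL4 : 4 ≤ F.L) (hn₁ : 13 ≤ C.n₁) (hR1 : ∀ K, K₀ ≤ K → ∀ t, 1 ≤ R K t)
    -- H3: the terms read as pedigrees REALISED BY THE RUN'S OWN PROFILE with their DOMAINS (root cells := `cellOfR`)
    (ped : ℕ → ι → Pedigree α π) (cellP : ℕ → ι → π → Pt d × Finset (Pt d)) (liveC : ℕ → ι → Finset α)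
    (Zd : ℕ → ι → α → Finset (Pt d)) (H : RealisedDomainsR F.L (runProfile F.L R) n K₀ R T ped cellP liveC Zd)
    (hn : 0 < n)
    -- H3: realised per-step costs of the live members, read below the model's booked cost (reading (ID-a))
    -- the class-linear slack: `C.a + θ ≤ ½γ₀A₁²` pays a factor `e^{θ·birthLinT}` per member (row S6g′'s multiplicity)
    {θ : ℝ} (hθ : 0 ≤ θ) (hslack : C.a + θ ≤ O.γ₀ * O.A₁ ^ 2 / 2)
    (κ κ' : ℕ → (Fin d → ℕ) × Gen (Lab α π) → Gen (Lab α π) → ℕ → ℝ)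
    (hκ : ∀ K, K₀ ≤ K → ∀ τ ∈ badTerms (memOf ped liveC (cellOfR n F.L (runProfile F.L R) ped cellP)) jhalf T K, ∀ q ∈ memOf ped liveC (cellOfR n F.L (runProfile F.L R) ped cellP) K τ,
      ∀ m ∈ life (padW (dictWT Prod.fst (R K) C.n₁) 0) q.2,
        κ K q q.2 m ≤ costT Prod.fst C K (R K) q.2 m)
    (hκ' : ∀ K, K₀ ≤ K → ∀ τ ∈ badTerms (memOf ped liveC (cellOfR n F.L (runProfile F.L R) ped cellP)) jhalf T K, ∀ q ∈ memOf ped liveC (cellOfR n F.L (runProfile F.L R) ped cellP) K τ,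
      ∀ m ∈ life (padW (dictWT Prod.fst (R K) C.n₁) 0) q.2,
        κ' K q q.2 m ≤ costT Prod.fst C K (R K) q.2 m)
    -- H3: the per-term price sentence in PRINT's currency, both runs
    {Fc Rf Fc' Rf' : ℕ → Finset (BSlot (Fin d → ℕ) PEv) → ℝ}
    (hP : ∀ K t, |t| ≤ l₀ → K₀ ≤ K → ∀ τ ∈ badTerms (memOf ped liveC (cellOfR n F.L (runProfile F.L R) ped cellP)) jhalf T K,
      Fc K (bstrOf Prod.fst (memOf ped liveC (cellOfR n F.L (runProfile F.L R) ped cellP)) K τ) * Rf K (bstrOf Prod.fst (memOf ped liveC (cellOfR n F.L (runProfile F.L R) ped cellP)) K τ) ≤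
        ∏ q ∈ memOf ped liveC (cellOfR n F.L (runProfile F.L R) ped cellP) K τ,
          pshapeTH Prod.fst O C 1 ((F.L : ℝ) ^ d) (R K) (D.C ⟨K, F.m, g₀ K⟩).flow.g 0 (κ K q) q.2 *
            Real.exp (θ * birthLinT Prod.fst q.2))
    (hP' : ∀ K t, |t| ≤ l₀ → K₀ ≤ K → ∀ τ ∈ badTerms (memOf ped liveC (cellOfR n F.L (runProfile F.L R) ped cellP)) jhalf T K,
      Fc' K (bstrOf Prod.fst (memOf ped liveC (cellOfR n F.L (runProfile F.L R) ped cellP)) K τ) * Rf' K (bstrOf Prod.fst (memOf ped liveC (cellOfR n F.L (runProfile F.L R) ped cellP)) K τ) ≤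
        ∏ q ∈ memOf ped liveC (cellOfR n F.L (runProfile F.L R) ped cellP) K τ,
          pshapeTH Prod.fst O C 1 ((F.L : ℝ) ^ d) (R K) (D.C ⟨K, F.m, g₀ K⟩).flow.g 0 (κ' K q) q.2 *
            Real.exp (θ * birthLinT Prod.fst q.2))
    -- H3: the remaining `Regeneration` numerator readings, over the classes of the terms
    (up : ∀ K t, |t| ≤ l₀ → K₀ ≤ K → ∀ c ∈ badClasses Prod.fst (memOf ped liveC (cellOfR n F.L (runProfile F.L R) ped cellP)) jhalf T K,
      ∀ τ ∈ fibre (bstrOf Prod.fst (memOf ped liveC (cellOfR n F.L (runProfile F.L R) ped cellP))) T K c, A K t τ ≤ dead K t τ * Fc K c * nup K t)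
    (dead_nonneg : ∀ K t, |t| ≤ l₀ → K₀ ≤ K → ∀ c ∈ badClasses Prod.fst (memOf ped liveC (cellOfR n F.L (runProfile F.L R) ped cellP)) jhalf T K,
      ∀ τ ∈ fibre (bstrOf Prod.fst (memOf ped liveC (cellOfR n F.L (runProfile F.L R) ped cellP))) T K c, 0 ≤ dead K t τ)
    (resum : ∀ K t, |t| ≤ l₀ → K₀ ≤ K → ∀ c ∈ badClasses Prod.fst (memOf ped liveC (cellOfR n F.L (runProfile F.L R) ped cellP)) jhalf T K,
      ∑ τ ∈ fibre (bstrOf Prod.fst (memOf ped liveC (cellOfR n F.L (runProfile F.L R) ped cellP))) T K c, dead K t τ ≤ Rf K c)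
    (F_nonneg : ∀ K t, |t| ≤ l₀ → K₀ ≤ K → ∀ c ∈ badClasses Prod.fst (memOf ped liveC (cellOfR n F.L (runProfile F.L R) ped cellP)) jhalf T K, 0 ≤ Fc K c)
    (up' : ∀ K t, |t| ≤ l₀ → K₀ ≤ K → ∀ c ∈ badClasses Prod.fst (memOf ped liveC (cellOfR n F.L (runProfile F.L R) ped cellP)) jhalf T K,
      ∀ τ ∈ fibre (bstrOf Prod.fst (memOf ped liveC (cellOfR n F.L (runProfile F.L R) ped cellP))) T K c, A' K t τ ≤ dead' K t τ * Fc' K c * mup K t)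
    (dead'_nonneg : ∀ K t, |t| ≤ l₀ → K₀ ≤ K → ∀ c ∈ badClasses Prod.fst (memOf ped liveC (cellOfR n F.L (runProfile F.L R) ped cellP)) jhalf T K,
      ∀ τ ∈ fibre (bstrOf Prod.fst (memOf ped liveC (cellOfR n F.L (runProfile F.L R) ped cellP))) T K c, 0 ≤ dead' K t τ)
    (resum' : ∀ K t, |t| ≤ l₀ → K₀ ≤ K → ∀ c ∈ badClasses Prod.fst (memOf ped liveC (cellOfR n F.L (runProfile F.L R) ped cellP)) jhalf T K,
      ∑ τ ∈ fibre (bstrOf Prod.fst (memOf ped liveC (cellOfR n F.L (runProfile F.L R) ped cellP))) T K c, dead' K t τ ≤ Rf' K c)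
    (F'_nonneg : ∀ K t, |t| ≤ l₀ → K₀ ≤ K → ∀ c ∈ badClasses Prod.fst (memOf ped liveC (cellOfR n F.L (runProfile F.L R) ped cellP)) jhalf T K,
      0 ≤ Fc' K c)
    -- the seam's other inputs
    (hSh : ShellWeightBound l₀ T A A' shA shB Wsh)
    (hTB : ReindexedBudget l₀ vol T (fun K t τ => A K t τ - shA K t τ) (fun K t τ => A' K t τ - shB K t τ)
      (badOfClass (bstrOf Prod.fst (memOf ped liveC (cellOfR n F.L (runProfile F.L R) ped cellP))) T
        (fun K _ => badClasses Prod.fst (memOf ped liveC (cellOfR n F.L (runProfile F.L R) ped cellP)) jhalf T K)) Cc Rr CcRec RrRec ν u s₂ q₀ r s)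
    (hr : Summable r) (hu : Summable u) (hs : Summable s) (hs₂ : Summable s₂) :
    ∃ K₁ K₂, K₀ ≤ K₁ ∧ HybridNE7 l₀ vol (fun K => T (K₁ + (K₂ + K))) (fun K => A (K₁ + (K₂ + K)))
      (fun K => A' (K₁ + (K₂ + K)))
      (fun K => badOfClass (bstrOf Prod.fst (memOf ped liveC (cellOfR n F.L (runProfile F.L R) ped cellP))) T
        (fun K _ => badClasses Prod.fst (memOf ped liveC (cellOfR n F.L (runProfile F.L R) ped cellP)) jhalf T K) (K₁ + (K₂ + K)))
      (fun K => constOf l₀ B (max (em g) 0) n₁ c₀ Nup *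
        recordsBudget (birthMass C) C.κ₁ ((n : ℝ) ^ d) ((F.L : ℝ) ^ d) (Real.log 2) jhalf (K₁ + (K₂ + K)))
      (fun K => shA (K₁ + (K₂ + K))) (fun K => shB (K₁ + (K₂ + K))) (fun K => Wsh (K₁ + (K₂ + K)))
      (fun K => (r (K₁ + (K₂ + K)) + u (K₁ + (K₂ + K))) + (s (K₁ + (K₂ + K)) + s₂ (K₁ + (K₂ + K)))) :=
  hybridNE7_of_realisedRun_printedSlack D h hμ d n hκ₁ hE₀ hA₀ hb hlo hhi hγ hγβ S hp₀ hrr hβ ht hir hsign hcor hγB hobs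
    hbd hα hα' hc₀ hfloor hfloor' hsites hsites' hNup hnup hmup R hR hL4 hn₁ hR1 ped cellP liveC
    (cellOfR n F.L (runProfile F.L R) ped cellP)
    (realisedReadingR_of_domainsRun D hb hlo hhi hγ hγβ S hrr hβ ht R hR hn H) hθ hslack κ κ' hκ hκ' hP hP' up
    dead_nonneg resum F_nonneg up' dead'_nonneg resum' F'_nonneg hSh hTB hr hu hs hs₂

end End

end

end Summit.QuantumFields.BalabanUV.T4Continuum.HistoryRealiseCellsRunSlack
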